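import Literature.NumberTheory.EllipticCurves.ShintaniNullOrbits
import Literature.NumberTheory.EllipticCurves.ShintaniDefiniteOrbits
import HarnessLib

/-!
# The unfolded Shintani lift: only the orbits of indefinite vectors survive

[[cite: Shintani1975, §2, (2.14), Prop. 2.3]] — "`θ(z, ψ) = ∑_x κ(c, x) ∫_{C(x,Γ)} …` where the
summation is taken over all `Γ`-equivalence classes of `L` with positive discriminant."  For the
twisted lift `Φ_D` of `φ ∈ S₂(Γ₀(64))` (`D` odd) we PROVE the corresponding statement with the
orbit integrals left unevaluated:

* `orbitIntegral D φ z ω = ∫_{F_ω} term(k_ω)` (`k_ω = ω.out`);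
* `orbitIntegral_eq_zero_of_disc_nonpos` — `J(ω) = 0` when `disc ι♮(k_ω) ≤ 0` (the zero vector,
  `ShintaniNullOrbits`, `ShintaniDefiniteOrbits`);
* **`shintaniLift_eq_tsum_orbitIntegral`** —
  `Φ_D(z) = √(Im z) ∑_{ω : disc ι♮(k_ω) > 0} J(ω)` (`ShintaniLiftTermwise`, `OrbitStabilizerSums`,
  `ShintaniOrbitUnfolding`).

No named facts; the only definition is `orbitIntegral`.
-/

noncomputable section

open scoped MatrixGroups ModularForm Modular Topology ENNReal Pointwise Manifold
open UpperHalfPlane hiding I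
open Complex Filter MeasureTheory Set CongruenceSubgroup ModularGroup Real MulAction
open Literature.NumberTheory.EllipticCurves.ModularForms

namespace Literature.NumberTheory.EllipticCurves.Shintani

variable (D : ℕ) [NeZero D]

/-- The zero vector contributes nothing: `term(0) = 0` (`x(w,1) = 0`). [folklore] -/
theorem liftTerm_zero_vec (φ : ℍ → ℂ) (z w : ℍ) : liftTerm D φ z 0 w = 0 := by
  have h0 : latSharp 0 = 0 := by
    ext i; fin_cases i <;> simp [latSharp]
  have hf : formEval (0 : V) (w : ℂ) = 0 := by simp [formEval]
  simp [liftTerm, h0, shintaniFn, hf]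

/-- **The orbit integral of `ω`**: `J(ω) = ∫_{F_{ω}} term(k_ω)`, `k_ω = ω.out`. [folklore] -/
def orbitIntegral (φ : ℍ → ℂ) (z : ℍ) (ω : orbitRel.Quotient (Gamma0Plus 64) (Fin 3 → ℤ)) : ℂ :=
  ∫ w in orbitDomain ω.out, liftTerm D φ z ω.out w

/-- **Non-indefinite orbits contribute `0`** (`D` odd, `φ ∈ S₂(Γ₀(64))`): if `disc ι♮(k_ω) ≤ 0` then
`J(ω) = 0` — the zero vector (`term = 0`), the null vectors (`ShintaniNullOrbits`) and the
definite vectors (`ShintaniDefiniteOrbits`). [cite: Shintani1975, §2, proof of Prop. 2.3] -/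
theorem orbitIntegral_eq_zero_of_disc_nonpos (hD : Odd D) (f : CuspForm (Gamma0 64) 2) (z : ℍ)
    (ω : orbitRel.Quotient (Gamma0Plus 64) (Fin 3 → ℤ)) (hω : disc (latSharp ω.out) ≤ 0) :
    orbitIntegral D f z ω = 0 := by
  unfold orbitIntegral
  rcases lt_or_eq_of_le hω with hneg | hnull
  · exact integral_orbitDomain_eq_zero_of_disc_neg D hD f z hneg
  · by_cases hk : ω.out = 0
    · rw [hk]
      simp_rw [liftTerm_zero_vec]
      exact integral_zero _ _
    · exact integral_orbitDomain_eq_zero_of_null hD f z hnull hk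

/-- **The unfolded lift**: for `D` odd and `φ ∈ S₂(Γ₀(64))`,
`Φ_D(z) = √(Im z) ∑_{ω ∈ ℤ³/Γ₀(64)⁺, disc ι♮(k_ω) > 0} J(ω)`, the sum over the orbits of INDEFINITE
lattice vectors of the orbit integrals `J(ω) = ∫_{Γ_ω∖ℍ} φ(w) c_D(k_ω) f_{w,Z}(ι♮ k_ω) dμ(w)`
(written with an indicator; the sum is absolutely convergent). [cite: Shintani1975, §2, (2.14)] -/
theorem shintaniLift_eq_tsum_orbitIntegral (hD : Odd D) (f : CuspForm (Gamma0 64) 2) (z : ℍ) :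
    shintaniLift D f z = (Real.sqrt z.im : ℂ) *
      ∑' ω : orbitRel.Quotient (Gamma0Plus 64) (Fin 3 → ℤ),
        (if 0 < disc (latSharp ω.out) then orbitIntegral D f z ω else 0) := by
  rw [shintaniLift_eq_tsum_integral D f z]
  congr 1
  have hsum : Summable fun k : Fin 3 → ℤ ↦ ∫ w in liftDomain, liftTerm D f z k w :=
    (summable_norm_integral_liftTerm D f z).of_norm
  rw [tsum_eq_tsum_orbits_quotient (G := Gamma0Plus 64) hsum]
  refine tsum_congr fun ω ↦ ?_
  rw [(tsum_quotient_integral_liftTerm_eq hD f z ω.out).2]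
  split_ifs with h
  · rfl
  · exact orbitIntegral_eq_zero_of_disc_nonpos D hD f z ω (not_lt.mp h)

end Literature.NumberTheory.EllipticCurves.Shintani
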